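import Summits.BirchSwinnertonDyer.BirchSwinnertonDyer.Theorems.Rank1ResidualIntModelReduction
import Summits.BirchSwinnertonDyer.Rank1Residual.X11b.BDPRouteTamagawaSupport
import Summits.BirchSwinnertonDyer.Rank1Residual.X9.PrintCertBridge
import HarnessLib

/-!
# Route `ErratumRoadFive`, crux `EulerHalfNotRamNoInertSetAtFive` (item stmt-BirchSwinnertonDyer-19715), line `birth` (v10–v13): the LOCAL
# CERTIFICATE of the registered BC5 rung pair **(605a1, 5)** — the smallest pair of piece S1b «`p` the ONLY multiplicative prime, split,
# `p ∣ ord_p Δ_min`» (the exceptional-zero core, 334 of the 404 census pairs) — every LOCAL binder of `stub_rung_res_605a1` HOLDS in the kernel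

Cell `bsd-stepL`, seat `bsd-line-er5-p1-w4` (D-0154 width seat -w4 on crux 19715, lead `bsd-line-er5-p1`), `--supports stmt-BirchSwinnertonDyer-19715
--as helper`. THEOREMS ONLY, route-independent (no `Theses` import). ONE curve: `E = [1,−1,0,−1414,−44027]` = Cremona 605a1 (`N = 605 = 5·11²`,
`Δ_min = −5⁵·11⁸`, `c₄ = 3·11³·17`): multiplicative at `5` ONLY (`5 ∣ Δ`, `5 ∤ c₄`; `11` is additive: `11 ∣ Δ`, `11 ∣ c₄`), SPLIT at `5` (the
node-tangent quadratic has the root `t = 0` mod `5`), and `ord₅Δ_min = 5` — so `5` is a SELF-CARRIER (`5 ∣ ord₅Δ_min`), there is no (W)-witness,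
no multiplicative prime `≠ 5` at all (`¬ Ram E 5` holds outright), `5 ∣ ∏ c_ℓ(E)` (`c₅ = ord₅Δ_min = 5`; tree `X11b.dvd_tamagawaProduct_iff_exists_split`),
and NO even set `S ∋ 5` of multiplicative primes exists (`S ⊆ {5}`), nor any split-set datum `S ∌ 5` (then `S = ∅` and the offending split prime `5`
lies off `S`). In the registered rung `Statement.stub_rung_res_605a1` of `Cruxes/…/Lines/birth.lean` (v12: DERIVED modulo the route items + the
citable stub as `Birth.rung_res_605a1_of_printFacts`, lead g1) the binders «`∀ ℓ, Mult E ℓ → ℓ = 5`», «`E` split multiplicative at `5`»,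
«`5 ∣ ord₅Δ_min`», `¬ Ram E 5`, `5 ∣ ∏c` are therefore TRUE statements (`binders_hold`), i.e. the rung is non-vacuous modulo exactly the pair's
analytic ∕ Galois data (`r_an = 1`, `Irr`, `Surj` — Cremona's tables: rank 1, `galrep` no exceptional prime; not kernel statements). Pattern of
-w3 g0's `Rung129360cy1.binders_hold` (p627895) and of this seat's `…RungsSplitSetTwoBinders.lean`.

HONEST FRAMING: local facts of one explicit curve + bookkeeping; no definition, no named fact, no `sorry`; a helper, not a closure of crux 19715 and
not a proof of the rung's conclusion (S1b is the beyond-print exceptional-zero core: closed in the line only modulo print + `X11aLowerHalf`);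
BSD(605a1, 5) is NOT proved by this; nothing booked; no summit statement is touched. References: [Cremona1997] Table 1 (curve 605a1);
[SilvermanAEC2009] VII.5 Prop. 5.1(b),(c); [SilvermanATAEC1994] Cor. IV.9.2(d); [SkinnerUrban2014] Thm. 2; [PastenShimura2024] §6.6.
-/

noncomputable section

open scoped Classical

open WeierstrassCurve NumberField IsDedekindDomain Literature.NumberTheory.EllipticCurves
  Literature.NumberTheory.EllipticCurves.Rank1Residual Summit.BirchSwinnertonDyer.Rank1Residual
  Summit.BirchSwinnertonDyer.BirchSwinnertonDyer.Rank1Residual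

set_option linter.dupNamespace false -- the cell's Theorems namespace repeats the summit name, as in every sibling file

namespace Summit.BirchSwinnertonDyer.BirchSwinnertonDyer.Theorems.EulerHalfSplitTwinRoad.Rung605a1

/-! ### Integer-model facts of 605a1 = `[1,−1,0,−1414,−44027]` (`Δ_min = −5⁵·11⁸`, `c₄ = 3·11³·17`) -/

/-- `Δ(E₀) = −669871503125 = −5⁵·11⁸` on the integer equation. [cite: Cremona1997, Table 1 (curve 605a1)] -/
theorem Δ_eq : (⟨1, -1, 0, -1414, -44027⟩ : WeierstrassCurve ℤ).Δ = -669871503125 := by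
  norm_num [WeierstrassCurve.Δ, WeierstrassCurve.b₂, WeierstrassCurve.b₄, WeierstrassCurve.b₆, WeierstrassCurve.b₈]

/-- `c₄(E₀) = 67881 = 3·11³·17` on the integer equation. [cite: Cremona1997, Table 1 (curve 605a1)] -/
theorem c₄_eq : (⟨1, -1, 0, -1414, -44027⟩ : WeierstrassCurve ℤ).c₄ = 67881 := by
  norm_num [WeierstrassCurve.c₄, WeierstrassCurve.b₂, WeierstrassCurve.b₄]

/-- The tree's integral model of `E` is the integer equation itself. [folklore] -/
theorem integralModelInt_eq [((⟨1, -1, 0, -1414, -44027⟩ : WeierstrassCurve ℤ).baseChange ℚ).IsGloballyMinimal] :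
    integralModelInt ((⟨1, -1, 0, -1414, -44027⟩ : WeierstrassCurve ℤ).baseChange ℚ) = (⟨1, -1, 0, -1414, -44027⟩ : WeierstrassCurve ℤ) :=
  IntModel.integralModelInt_eq_of_map_eq _ (by
    rw [WeierstrassCurve.baseChange, show algebraMap ℤ ℚ = Int.castRingHom ℚ from rfl])

/-- `Δ_min(E) = −669871503125`. [cite: Cremona1997, Table 1 (curve 605a1)] -/
theorem minimalDiscriminantInt_eq [((⟨1, -1, 0, -1414, -44027⟩ : WeierstrassCurve ℤ).baseChange ℚ).IsGloballyMinimal] :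
    ((⟨1, -1, 0, -1414, -44027⟩ : WeierstrassCurve ℤ).baseChange ℚ).minimalDiscriminantInt = -669871503125 := by
  rw [IntModel.minimalDiscriminantInt_eq integralModelInt_eq, Δ_eq]

/-- **`E` is multiplicative at `5`** (`5 ∣ Δ`, `5 ∤ c₄`; Silverman AEC VII.5.1(b)). [cite: SilvermanAEC2009, VII.5 Prop. 5.1(b)] -/
theorem mult_five [Fact (Nat.Prime 5)] [((⟨1, -1, 0, -1414, -44027⟩ : WeierstrassCurve ℤ).baseChange ℚ).IsElliptic]
    [((⟨1, -1, 0, -1414, -44027⟩ : WeierstrassCurve ℤ).baseChange ℚ).IsGloballyMinimal] :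
    Mult ((⟨1, -1, 0, -1414, -44027⟩ : WeierstrassCurve ℤ).baseChange ℚ) 5 :=
  IntModel.hasMultiplicativeReductionAtPrime_of_intModel integralModelInt_eq 5 (by rw [Δ_eq]; norm_num) (by rw [c₄_eq]; norm_num)

/-- The node-tangent quadratic `c₄t² + a₁c₄t − (54b₆ − 3b₂b₄ + a₂c₄)` of the integer equation has the root `t = 0` modulo `5`.
[cite: SilvermanAEC2009, VII.5 Prop. 5.1(b)] -/
theorem nodal_root_five :
    ∃ t : ZMod 5, ((⟨1, -1, 0, -1414, -44027⟩ : WeierstrassCurve ℤ).c₄ : ZMod 5) * t ^ 2 +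
      ((⟨1, -1, 0, -1414, -44027⟩ : WeierstrassCurve ℤ).a₁ * (⟨1, -1, 0, -1414, -44027⟩ : WeierstrassCurve ℤ).c₄ : ZMod 5) * t -
        (54 * (⟨1, -1, 0, -1414, -44027⟩ : WeierstrassCurve ℤ).b₆ - 3 * (⟨1, -1, 0, -1414, -44027⟩ : WeierstrassCurve ℤ).b₂ *
          (⟨1, -1, 0, -1414, -44027⟩ : WeierstrassCurve ℤ).b₄ + (⟨1, -1, 0, -1414, -44027⟩ : WeierstrassCurve ℤ).a₂ *
          (⟨1, -1, 0, -1414, -44027⟩ : WeierstrassCurve ℤ).c₄ : ZMod 5) = 0 :=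
  ⟨0, by simp only [WeierstrassCurve.c₄, WeierstrassCurve.b₂, WeierstrassCurve.b₄, WeierstrassCurve.b₆]; decide⟩

/-- **`E` is SPLIT multiplicative at `5`** (a binder of the rung ∕ of S1b): the node-tangent quadratic has a root modulo `5`.
[cite: SilvermanAEC2009, VII.5 Prop. 5.1(b)] [cite: Cremona1997, Table 1 (curve 605a1)] -/
theorem split_five [Fact (Nat.Prime 5)] [((⟨1, -1, 0, -1414, -44027⟩ : WeierstrassCurve ℤ).baseChange ℚ).IsElliptic]
    [((⟨1, -1, 0, -1414, -44027⟩ : WeierstrassCurve ℤ).baseChange ℚ).IsGloballyMinimal] :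
    ((⟨1, -1, 0, -1414, -44027⟩ : WeierstrassCurve ℤ).baseChange ℚ).HasSplitMultiplicativeReductionAtPrime 5 :=
  IntModel.hasSplitMultiplicativeReductionAtPrime_of_intModel_of_root integralModelInt_eq 5
    (by rw [Δ_eq]; norm_num) (by rw [c₄_eq]; norm_num) nodal_root_five

/-- **`E` is NOT multiplicative at `11`** (`11 ∣ Δ`, `11 ∣ c₄`: additive, `11² ∥ N`). [cite: SilvermanAEC2009, VII.5 Prop. 5.1(c)]
[cite: Cremona1997, Table 1 (curve 605a1)] -/
theorem not_mult_eleven [Fact (Nat.Prime 11)] [((⟨1, -1, 0, -1414, -44027⟩ : WeierstrassCurve ℤ).baseChange ℚ).IsElliptic]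
    [((⟨1, -1, 0, -1414, -44027⟩ : WeierstrassCurve ℤ).baseChange ℚ).IsGloballyMinimal] :
    ¬ ((⟨1, -1, 0, -1414, -44027⟩ : WeierstrassCurve ℤ).baseChange ℚ).HasMultiplicativeReductionAtPrime 11 :=
  Summit.BirchSwinnertonDyer.Rank1Residual.X9.PrintCert.not_hasMultiplicativeReductionAtPrime_of_dvd_of_dvd integralModelInt_eq 11
    (by rw [Δ_eq]; norm_num) (by rw [c₄_eq]; norm_num)

/-- `ord₅Δ_min(E) = 5`. [cite: Cremona1997, Table 1 (curve 605a1)] -/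
theorem padicValInt_five_eq [Fact (Nat.Prime 5)] [((⟨1, -1, 0, -1414, -44027⟩ : WeierstrassCurve ℤ).baseChange ℚ).IsGloballyMinimal] :
    padicValInt 5 ((⟨1, -1, 0, -1414, -44027⟩ : WeierstrassCurve ℤ).baseChange ℚ).minimalDiscriminantInt = 5 := by
  rw [minimalDiscriminantInt_eq]
  exact IntModel.padicValInt_eq_of_dvd_of_not_dvd 5 (e := 5) (by norm_num) (by norm_num)

/-- **`5` is a SELF-CARRIER: `5 ∣ ord₅Δ_min(E) = 5`** (a binder of the rung ∕ of S1b; no (W)-witness at the pair). [cite: Cremona1997, Table 1 (curve 605a1)] -/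
theorem five_dvd_padicValInt_five [Fact (Nat.Prime 5)] [((⟨1, -1, 0, -1414, -44027⟩ : WeierstrassCurve ℤ).baseChange ℚ).IsGloballyMinimal] :
    5 ∣ padicValInt 5 ((⟨1, -1, 0, -1414, -44027⟩ : WeierstrassCurve ℤ).baseChange ℚ).minimalDiscriminantInt := by
  rw [padicValInt_five_eq]

/-- A prime dividing `Δ_min(E) = −5⁵·11⁸` is `5` or `11`. [cite: Cremona1997, Table 1 (curve 605a1)] -/
theorem eq_of_prime_dvd_Δ {ℓ : ℕ} (hℓ : ℓ.Prime) (h : (ℓ : ℤ) ∣ -669871503125) : ℓ = 5 ∨ ℓ = 11 := by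
  have h' : ℓ ∣ 5 ^ 5 * 11 ^ 8 := by
    have h1 : (ℓ : ℤ) ∣ ((669871503125 : ℕ) : ℤ) := by
      rw [← dvd_neg]; exact_mod_cast h
    have h2 : ℓ ∣ 669871503125 := Int.natCast_dvd_natCast.mp h1
    norm_num
    exact h2
  rcases (Nat.Prime.dvd_mul hℓ).mp h' with h1 | h1
  · exact Or.inl ((Nat.prime_dvd_prime_iff_eq hℓ Nat.prime_five).mp (hℓ.dvd_of_dvd_pow h1))
  · exact Or.inr ((Nat.prime_dvd_prime_iff_eq hℓ (by norm_num)).mp (hℓ.dvd_of_dvd_pow h1))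

/-- **`5` is the ONLY multiplicative prime of `E`** (a binder of the rung ∕ of S1b, VERBATIM shape): a multiplicative prime divides
`Δ_min = −5⁵·11⁸`, and `11` is additive. [cite: Cremona1997, Table 1 (curve 605a1)] [cite: SilvermanAEC2009, VII.5 Prop. 5.1(b),(c)] -/
theorem eq_five_of_mult [((⟨1, -1, 0, -1414, -44027⟩ : WeierstrassCurve ℤ).baseChange ℚ).IsElliptic]
    [((⟨1, -1, 0, -1414, -44027⟩ : WeierstrassCurve ℤ).baseChange ℚ).IsGloballyMinimal] :
    ∀ (ℓ : ℕ) [Fact ℓ.Prime], ((⟨1, -1, 0, -1414, -44027⟩ : WeierstrassCurve ℤ).baseChange ℚ).HasMultiplicativeReductionAtPrime ℓ → ℓ = 5 := by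
  intro ℓ hℓF hm
  have hdvd : (ℓ : ℤ) ∣ ((⟨1, -1, 0, -1414, -44027⟩ : WeierstrassCurve ℤ).baseChange ℚ).minimalDiscriminantInt := by
    by_contra h
    exact WeierstrassCurve.HasMultiplicativeReduction.not_hasGoodReduction (R := ℤ_[ℓ]) hm
      (WeierstrassCurve.hasGoodReductionAtPrime_of_not_dvd _ ℓ h)
  rw [minimalDiscriminantInt_eq] at hdvd
  rcases eq_of_prime_dvd_Δ hℓF.out hdvd with h | rfl
  · exact h
  · exact absurd hm not_mult_eleven

/-! ### The binders of the rung at (605a1, 5) -/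

/-- **¬(ram) at (605a1, 5)** — outright: there is no multiplicative prime `≠ 5` at all. [cite: SkinnerUrban2014, Thm. 2 (p. 3), second bullet]
[cite: Cremona1997, Table 1 (curve 605a1)] -/
theorem not_ram_five [Fact (Nat.Prime 5)] [((⟨1, -1, 0, -1414, -44027⟩ : WeierstrassCurve ℤ).baseChange ℚ).IsElliptic]
    [((⟨1, -1, 0, -1414, -44027⟩ : WeierstrassCurve ℤ).baseChange ℚ).IsGloballyMinimal] :
    ¬ Ram ((⟨1, -1, 0, -1414, -44027⟩ : WeierstrassCurve ℤ).baseChange ℚ) 5 := by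
  rintro ⟨ℓ, hℓF, hℓ5, hm, -⟩
  exact hℓ5 (eq_five_of_mult ℓ hm)

/-- **`5 ∣ ∏ c_ℓ(E)`**: the split self-carrier `5` has `5 ∣ ord₅Δ_min = 5 = c₅` (tree `X11b.dvd_tamagawaProduct_iff_exists_split`; in fact `∏ c_ℓ = 5`,
`c₁₁ = 1`). [cite: SilvermanATAEC1994, Cor. IV.9.2(d) (PDF p. 340)] [cite: Cremona1997, Table 1 (curve 605a1)] -/
theorem five_dvd_tamagawaProduct [Fact (Nat.Prime 5)] [((⟨1, -1, 0, -1414, -44027⟩ : WeierstrassCurve ℤ).baseChange ℚ).IsElliptic]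
    [((⟨1, -1, 0, -1414, -44027⟩ : WeierstrassCurve ℤ).baseChange ℚ).IsGloballyMinimal] :
    5 ∣ ((⟨1, -1, 0, -1414, -44027⟩ : WeierstrassCurve ℤ).baseChange ℚ).tamagawaProduct :=
  (X11b.dvd_tamagawaProduct_iff_exists_split ((⟨1, -1, 0, -1414, -44027⟩ : WeierstrassCurve ℤ).baseChange ℚ) Nat.prime_five le_rfl).mpr
    ⟨5, inferInstance, split_five, five_dvd_padicValInt_five⟩

/-- **NO INERT SET at (605a1, 5)** — the strongest form (no degree ∕ pairing clause): an even set `S ∋ 5` of multiplicative primes of `E` would be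
contained in `{5}`, i.e. `S = {5}`, of odd cardinality. (Piece S1 of line `birth`: for these pairs `S = R = ∅` is the only candidate SPLIT-SET
datum, and it fails because `5 ∉ S` offends — `no_splitSetDatum`.) [cite: Cremona1997, Table 1 (curve 605a1)] [cite: PastenShimura2024, §6.6] -/
theorem no_inertSet [Fact (Nat.Prime 5)] [((⟨1, -1, 0, -1414, -44027⟩ : WeierstrassCurve ℤ).baseChange ℚ).IsElliptic]
    [((⟨1, -1, 0, -1414, -44027⟩ : WeierstrassCurve ℤ).baseChange ℚ).IsGloballyMinimal] :
    ¬ ∃ S : Finset ℕ, (∀ ℓ ∈ S, ∃ _ : Fact ℓ.Prime, Mult ((⟨1, -1, 0, -1414, -44027⟩ : WeierstrassCurve ℤ).baseChange ℚ) ℓ) ∧ Even S.card ∧ 5 ∈ S := by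
  rintro ⟨S, hSm, hSe, h5⟩
  have hS : S = {5} := by
    refine Finset.Subset.antisymm ?_ (by simpa using h5)
    intro ℓ hℓ
    obtain ⟨hF, hm⟩ := hSm ℓ hℓ
    rw [Finset.mem_singleton]
    exact eq_five_of_mult ℓ hm
  rw [hS] at hSe
  exact absurd hSe (by decide)

/-- **NO SPLIT-SET DATUM at (605a1, 5)** (the line's road `road_splitSetAtFive`, relaxed half): a set `S ∌ 5` of multiplicative primes of `E` is
empty, and then the split self-carrier `5 ∉ S` offends. So the pair is in piece S1b proper, not on the road. [cite: Cremona1997, Table 1 (curve 605a1)]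
[cite: PastenShimura2024, Lemma 6.18] -/
theorem no_splitSetDatum [Fact (Nat.Prime 5)] [((⟨1, -1, 0, -1414, -44027⟩ : WeierstrassCurve ℤ).baseChange ℚ).IsElliptic]
    [((⟨1, -1, 0, -1414, -44027⟩ : WeierstrassCurve ℤ).baseChange ℚ).IsGloballyMinimal] :
    ¬ ∃ S : Finset ℕ, (∀ ℓ ∈ S, ∃ _ : Fact ℓ.Prime, Mult ((⟨1, -1, 0, -1414, -44027⟩ : WeierstrassCurve ℤ).baseChange ℚ) ℓ) ∧
      Even S.card ∧ 5 ∉ S ∧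
      (∀ (ℓ : ℕ) [Fact ℓ.Prime], ℓ ∉ S → ((⟨1, -1, 0, -1414, -44027⟩ : WeierstrassCurve ℤ).baseChange ℚ).HasSplitMultiplicativeReductionAtPrime ℓ →
        ¬ 5 ∣ padicValInt ℓ ((⟨1, -1, 0, -1414, -44027⟩ : WeierstrassCurve ℤ).baseChange ℚ).minimalDiscriminantInt) ∧
      ((∃ (ℓ₀ : ℕ) (_ : Fact ℓ₀.Prime), Mult ((⟨1, -1, 0, -1414, -44027⟩ : WeierstrassCurve ℤ).baseChange ℚ) ℓ₀ ∧ ℓ₀ ≠ 5 ∧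
          ¬ 5 ∣ padicValInt ℓ₀ ((⟨1, -1, 0, -1414, -44027⟩ : WeierstrassCurve ℤ).baseChange ℚ).minimalDiscriminantInt) ∨
        ∃ R ⊆ S, S.card = 2 * R.card ∧ ∀ q ∈ R, ¬ 5 ∣ q - 1) := by
  rintro ⟨S, -, -, h5, hFC, -⟩
  exact hFC 5 h5 split_five five_dvd_padicValInt_five

/-- **The LOCAL binders of the registered rung `stub_rung_res_605a1` ∕ of piece S1b HOLD at (605a1, 5)**: `Mult E 5 ∧ ¬ Ram E 5 ∧ 5 ∣ ∏c ∧
(∀ ℓ, Mult E ℓ → ℓ = 5) ∧ E split multiplicative at 5 ∧ 5 ∣ ord₅Δ_min ∧ «no inert-set datum»` (crux currency). The remaining binders `r_an = 1`, `Irr`,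
`Surj` are the pair's Cremona `allbsd`∕`galrep` data, not kernel statements. [cite: Cremona1997, Table 1 (curve 605a1)] -/
theorem binders_hold [Fact (Nat.Prime 5)] [((⟨1, -1, 0, -1414, -44027⟩ : WeierstrassCurve ℤ).baseChange ℚ).IsElliptic]
    [((⟨1, -1, 0, -1414, -44027⟩ : WeierstrassCurve ℤ).baseChange ℚ).IsGloballyMinimal] :
    Mult ((⟨1, -1, 0, -1414, -44027⟩ : WeierstrassCurve ℤ).baseChange ℚ) 5 ∧
      ¬ Ram ((⟨1, -1, 0, -1414, -44027⟩ : WeierstrassCurve ℤ).baseChange ℚ) 5 ∧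
      5 ∣ ((⟨1, -1, 0, -1414, -44027⟩ : WeierstrassCurve ℤ).baseChange ℚ).tamagawaProduct ∧
      (∀ (ℓ : ℕ) [Fact ℓ.Prime], ((⟨1, -1, 0, -1414, -44027⟩ : WeierstrassCurve ℤ).baseChange ℚ).HasMultiplicativeReductionAtPrime ℓ → ℓ = 5) ∧
      ((⟨1, -1, 0, -1414, -44027⟩ : WeierstrassCurve ℤ).baseChange ℚ).HasSplitMultiplicativeReductionAtPrime 5 ∧
      5 ∣ padicValInt 5 ((⟨1, -1, 0, -1414, -44027⟩ : WeierstrassCurve ℤ).baseChange ℚ).minimalDiscriminantInt ∧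
      ¬ (∃ S : Finset ℕ, (∀ ℓ ∈ S, ∃ _ : Fact ℓ.Prime, Mult ((⟨1, -1, 0, -1414, -44027⟩ : WeierstrassCurve ℤ).baseChange ℚ) ℓ) ∧ Even S.card ∧ 5 ∈ S ∧
        (∀ (ℓ : ℕ) [Fact ℓ.Prime], ℓ ∉ S → ((⟨1, -1, 0, -1414, -44027⟩ : WeierstrassCurve ℤ).baseChange ℚ).HasSplitMultiplicativeReductionAtPrime ℓ →
          ¬ 5 ∣ padicValInt ℓ ((⟨1, -1, 0, -1414, -44027⟩ : WeierstrassCurve ℤ).baseChange ℚ).minimalDiscriminantInt) ∧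
        (¬ 5 ∣ padicValInt 5 ((⟨1, -1, 0, -1414, -44027⟩ : WeierstrassCurve ℤ).baseChange ℚ).minimalDiscriminantInt ∨
          ∃ R ⊆ S, S.card = 2 * R.card ∧ ∀ q ∈ R, q ≠ 2 ∧ ¬ 5 ∣ q - 1)) :=
  ⟨mult_five, not_ram_five, five_dvd_tamagawaProduct, eq_five_of_mult, split_five, five_dvd_padicValInt_five,
    fun ⟨S, hSm, hSe, h5, _, _⟩ ↦ no_inertSet ⟨S, hSm, hSe, h5⟩⟩

end Summit.BirchSwinnertonDyer.BirchSwinnertonDyer.Theorems.EulerHalfSplitTwinRoad.Rung605a1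

end
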